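import Summits.ResolutionOfSingularities.ResolutionOfSingularities.Theorems.PurelyInseparableDim4IrreducibilityCert
import Mathlib.RingTheory.Polynomial.UniqueFactorization
import HarnessLib

/-!
# A `decide`-able BLINDNESS certificate along an ALGEBRAIC (possibly non-rational) plane branch
# (cell `res-dim4-pi`; the scope column of the F4-C instrument ‖ K; genus-one components of `V(J₂⁺)`)

[OURS · counted 0 · instrument] Nothing here is a statement about resolution of singularities; resolution in
dimension `≥ 4` / characteristic `p > 0` is NOT proved by anything in this file.

The landed blindness checkers (`ScopeBlind.blindB` — monomial curves; `ScopeBlind.rblindB` — rational curves)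
certify `¬ InCoordinateScope q F` by a RATIONAL curve inside `V(J_q⁺(F))`.  The band-closure census of
res-dim4-p-13 (g2) meets `q = 2` states whose only non-coordinate component of `V(J₂⁺)` through the origin is
`𝔸¹ × C` with `C` a plane cubic of genus ONE — e.g. `F = x₂x₄ + x₂x₃x₄² + x₂x₃²` with
`V(J₂⁺) ⊇ {x₂ = 0, x₄ + x₃x₄² + x₃² = 0}`, and `t y² + y + t² = 0` is `Y² + Y = t³` after `Y = t y`: no rational
curve through the origin lies on it except the coordinate axis of `x₁`.  This file adds the certificate for that case,
still checked by `decide` on presented states (`StepKit.SData`):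

* §1 substitution of term lists in two variables (`substL`) with transfer to `MvPolynomial.aeval`;
* §2 (the `decide`-able IRREDUCIBILITY check `irredB` / `irreducible_of_irredB` lives in `…IrreducibilityCert`);
* §3 **`algBlindB q s cs D g h Q V α₀ a`**: the ring map `φ : K[x₁..x₄] → K[t,y]/(g)`, `xᵢ ↦ hᵢ(t,y)`, has
  (i) a DOMAIN as target (`g` irreducible, `MvPolynomial` is a UFD), (ii) `φ(D^{(α)}F) = 0` for `0 < |α| < q` by
  explicit quotients `Q_α` (`(D^{(α)}F)(h) = Q_α · g`, coefficient check), (iii) `ker φ ≤ 𝔪₀` because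
  `g(0,0) = 0 = hᵢ(0,0)`, (iv) `φ(xᵢ) ≠ 0` off `V` by a degree bound (`tdeg hᵢ < tdeg g`), (v) a Hasse derivative
  `D^{(α₀)}F`, `0 < |α₀| < q`, non-zero at a point `a` vanishing on `V`; soundness
  **`not_inCoordinateScope_of_algBlindB`** via res-dim4-p-3's `IsolationCert.not_inCoordinateScope_of_ringHom`;
* §4 acceptance (`decide`, `q = 2`, `𝔽₂`): the band-closure state above is BLIND
  (`not_inCoordinateScope_genusOne`), by the branch `x₃ ↦ t, x₄ ↦ y, x₁, x₂ ↦ 0` on `t y² + y + t² = 0`.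

OURS; counted 0; AI kernel work, weaker than expert review.  bears_on: LADDER-RESOLUTION:D157-DOOR2
(res-dim4-pi · F4-C instrument ‖ K · scope column).  Supports stmt-ResolutionOfSingularities-16155 (helper).
-/

set_option linter.dupNamespace false -- mandated namespace of this single-conjunct summit

noncomputable section

open MvPolynomial Finset
open scoped BigOperators

namespace Summit.ResolutionOfSingularities.ResolutionOfSingularities.Theorems.PIDim4

namespace ScopeBlind

open StepKit ScopeCover
open Literature.AlgebraicGeometry.Resolution

variable {K : Type} [Field K] [DecidableEq K]

/-! ## §1 Substituting two-variable term lists for `x₁, …, x₄` -/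

/-- `∏ᵢ hᵢ^{eᵢ}` on term lists in two variables (normalised products). [folklore] -/
def prodPow2 (h : Fin 4 → Terms 2 K) (e : Fin 4 → ℕ) : Terms 2 K :=
  mulN (mulN (mulN (powN (h 0) (e 0)) (powN (h 1) (e 1))) (powN (h 2) (e 2))) (powN (h 3) (e 3))

/-- Transfer of `prodPow2`. [folklore] -/
theorem evalT_prodPow2 (h : Fin 4 → Terms 2 K) (e : Fin 4 → ℕ) :
    evalT (prodPow2 h e) = ∏ i, evalT (h i) ^ e i := by
  simp only [prodPow2, evalT_mulN, evalT_powN, Fin.prod_univ_four]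

/-- The substitution `xᵢ ↦ hᵢ(t, y)` on term lists. [folklore] -/
def substL (h : Fin 4 → Terms 2 K) : Terms 4 K → Terms 2 K
  | [] => []
  | t :: L => mulTL (fun _ => 0, t.2) (prodPow2 h t.1) ++ substL h L

/-- **Transfer of the substitution**: `evalT (substL h L) = aeval (evalT ∘ h) (evalT L)`. [folklore] -/
theorem evalT_substL (h : Fin 4 → Terms 2 K) (L : Terms 4 K) :
    evalT (substL h L) = MvPolynomial.aeval (fun i => evalT (h i)) (evalT L) := by
  induction L with
  | nil => simp [substL]
  | cons t L ih =>
    rw [substL, evalT_append, ih, evalT_cons, map_add, evalT_mulTL, evalT_prodPow2, monomial_expo_eq,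
      monomial_expo_eq, map_mul, MvPolynomial.algHom_C, MvPolynomial.algebraMap_eq, map_prod]
    congr 1
    have h1 : (∏ k : Fin 2, (X k : MvPolynomial (Fin 2) K) ^ (fun _ : Fin 2 => (0 : ℕ)) k) = 1 := by simp
    rw [h1, mul_one]
    congr 1
    refine Finset.prod_congr rfl fun i _ => ?_
    rw [map_pow, MvPolynomial.aeval_X]

/-! ## §2 The algebraic-branch blindness certificate -/

omit [DecidableEq K] in
/-- Evaluation of a two-variable term list at the origin: its coefficient at `(0,0)`. [folklore] -/
theorem eval_zero_evalT2 (L : Terms 2 K) :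
    MvPolynomial.eval (0 : Fin 2 → K) (evalT L) = coeffAt L (fun _ => 0) := by
  rw [MvPolynomial.eval_zero]
  change coeff 0 (evalT L) = _
  rw [show (0 : Fin 2 →₀ ℕ) = expo (fun _ : Fin 2 => (0 : ℕ)) from ((expo_eq_zero_iff _).mpr rfl).symm,
    coeff_expo_evalT]

/-- **Algebraic-branch blindness check.**  Data: `cs` (all elements of `K`), `D` (total degree of `g`),
`g ∈ K[t,y]` (term list), the branch `h : Fin 4 → Terms 2 K` (`xᵢ ↦ hᵢ(t,y)`), quotients `Q` (one per Hasse
index of `idxLT q`, in order), `V` (coordinates allowed to vanish on the branch), `α₀`, `a`.  Checked: `g`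
irreducible of total degree exactly `D`; `g(0,0) = 0`; every `hᵢ(0,0) = 0`; for `i ∉ V`, `hᵢ` is non-constant-zero
with `tdeg hᵢ < D`; `(D^{(α)}F)(h) = Q_α · g` for every `α ∈ idxLT q`; `a` vanishes on `V`; `0 < |α₀| < q`;
`D^{(α₀)}F(a) ≠ 0`. [folklore] -/
def algBlindB (q : ℕ) (s : SData 4 K) (cs : List K) (D : ℕ) (g : Terms 2 K) (h : Fin 4 → Terms 2 K)
    (Q : List (Terms 2 K)) (V : Finset (Fin 4)) (α₀ : Fin 4 → ℕ) (a : Fin 4 → K) : Bool :=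
  irredB cs D g && ((live g).any fun e => decide (∑ i, e i = D)) &&
    decide (coeffAt g (fun _ => 0) = 0) &&
    decide (∀ i, coeffAt (h i) (fun _ => 0) = 0) &&
    decide (∀ i, i ∉ V → tdegL (h i) < D ∧ StepKit.equivB (h i) [] = false) &&
    decide ((idxLT q).length = Q.length) &&
    ((List.zip (idxLT q) Q).all fun αQ => StepKit.equivB (substL h (hasseL αQ.1 s.L)) (mulN αQ.2 g)) &&
    decide (∀ i ∈ V, a i = 0) &&
    decide (0 < ∑ i, α₀ i ∧ ∑ i, α₀ i < q) &&
    !decide (evalAtL a (hasseL α₀ s.L) = 0)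

/-- **Soundness of the algebraic-branch blindness check**: `K[t,y]/(g)` is a domain (irreducible `g` is prime in
the UFD `K[t,y]`); the substitution followed by the quotient map is res-dim4-p-3's kernel-form certificate.
[folklore] -/
theorem not_inCoordinateScope_of_algBlindB {q : ℕ} {s : SData 4 K} {cs : List K} (hcs : ∀ c : K, c ∈ cs)
    {D : ℕ} {g : Terms 2 K} {h : Fin 4 → Terms 2 K} {Q : List (Terms 2 K)} {V : Finset (Fin 4)}
    {α₀ : Fin 4 → ℕ} {a : Fin 4 → K} (hc : algBlindB q s cs D g h Q V α₀ a = true) :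
    ¬ InCoordinateScope q s.toState.F := by
  simp only [algBlindB, Bool.and_eq_true, decide_eq_true_eq, List.all_eq_true, List.any_eq_true,
    Bool.not_eq_true', decide_eq_false_iff_not] at hc
  obtain ⟨⟨⟨⟨⟨⟨⟨⟨⟨hirr, hdegD⟩, hg0⟩, hh0⟩, hV⟩, hlen⟩, hJ⟩, ha⟩, hα₀⟩, hne⟩ := hc
  -- the objects
  set G : MvPolynomial (Fin 2) K := evalT g with hGdef
  set H : Fin 4 → MvPolynomial (Fin 2) K := fun i => evalT (h i) with hHdef
  have hGirr : Irreducible G := irreducible_of_irredB hcs hirr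
  have hG0 : G ≠ 0 := hGirr.ne_zero
  have hGdeg : D ≤ G.totalDegree := by
    obtain ⟨e, he, hsum⟩ := hdegD
    have hsupp : expo e ∈ G.support := (expo_mem_support_iff g e).mpr he
    have := MvPolynomial.le_totalDegree hsupp
    rw [Finsupp.sum_fintype _ _ (fun _ => rfl)] at this
    simp only [expo_apply] at this
    rwa [hsum] at this
  let I : Ideal (MvPolynomial (Fin 2) K) := Ideal.span {G}
  haveI hIprime : I.IsPrime :=
    (Ideal.span_singleton_prime hG0).mpr (UniqueFactorizationMonoid.irreducible_iff_prime.mp hGirr)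
  let φ : MvPolynomial (Fin 4) K →+* MvPolynomial (Fin 2) K ⧸ I :=
    (Ideal.Quotient.mk I).comp (MvPolynomial.aeval H : MvPolynomial (Fin 4) K →ₐ[K] MvPolynomial (Fin 2) K).toRingHom
  haveI : IsDomain (MvPolynomial (Fin 2) K ⧸ I) := Ideal.Quotient.isDomain I
  have hφ : ∀ P : MvPolynomial (Fin 4) K, φ P = 0 ↔ MvPolynomial.aeval H P ∈ I := fun P => by
    change Ideal.Quotient.mk I (MvPolynomial.aeval H P) = 0 ↔ _
    exact Ideal.Quotient.eq_zero_iff_mem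
  have hdeg : (expo α₀).degree = ∑ i, α₀ i := degree_expo α₀
  refine IsolationCert.not_inCoordinateScope_of_ringHom φ (fun α h0 hq => ?_) (fun P hP => ?_) V
    (fun i hi => ?_) (expo α₀) (by rw [hdeg]; exact hα₀.1) (by rw [hdeg]; exact hα₀.2) a ha ?_
  · -- (ii) the Hasse derivatives die modulo `g`
    rw [hφ]
    have hmem : (⇑α) ∈ idxLT q := mem_idxLT h0 hq
    obtain ⟨k, hk, hkα⟩ := List.getElem_of_mem hmem
    have hkQ : k < Q.length := by rw [← hlen]; exact hk
    have hpair : ((idxLT q)[k], Q[k]) ∈ List.zip (idxLT q) Q := by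
      rw [List.mem_iff_getElem]
      exact ⟨k, by rw [List.length_zip]; exact lt_min hk hkQ, by rw [List.getElem_zip]⟩
    have heq := hJ _ hpair
    rw [hkα] at heq
    dsimp only at heq
    rw [← evalT_eq_iff_equivB, evalT_substL, evalT_mulN] at heq
    rw [SData.toState_F, ← expo_coe α, hasseDeriv_evalT]
    change MvPolynomial.aeval H (evalT (hasseL (⇑α) s.L)) ∈ Ideal.span {G}
    rw [heq]
    exact Ideal.mem_span_singleton'.mpr ⟨evalT Q[k], rfl⟩
  · -- (iii) the kernel is inside `𝔪₀`
    rw [hφ] at hP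
    obtain ⟨c, hcG⟩ := Ideal.mem_span_singleton'.mp hP
    have hH0 : (fun i => MvPolynomial.eval₂Hom (RingHom.id K) (0 : Fin 2 → K) (H i)) = (0 : Fin 4 → K) := by
      funext i
      change MvPolynomial.eval (0 : Fin 2 → K) (evalT (h i)) = 0
      rw [eval_zero_evalT2]; exact hh0 i
    have hev : MvPolynomial.eval (0 : Fin 2 → K) (MvPolynomial.aeval H P) =
        MvPolynomial.eval (0 : Fin 4 → K) P := by
      have key := MvPolynomial.eval₂Hom_bind₁ (RingHom.id K) (0 : Fin 2 → K) H P
      rw [hH0] at key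
      exact key
    rw [← hev, ← hcG, map_mul]
    change _ * MvPolynomial.eval (0 : Fin 2 → K) (evalT g) = 0
    rw [eval_zero_evalT2 g, hg0, mul_zero]
  · -- (iv) the coordinates off `V` survive
    obtain ⟨hlt, hnz⟩ := hV i hi
    rw [Ne, hφ, MvPolynomial.aeval_X]
    intro hmem
    have hHi0 : H i ≠ 0 := by
      intro h0
      have : StepKit.equivB (h i) [] = true := (evalT_eq_zero_iff (h i)).mp h0
      rw [hnz] at this; exact Bool.false_ne_true this
    have hdvd : G ∣ H i := Ideal.mem_span_singleton.mp hmem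
    have := totalDegree_le_of_dvd_of_isDomain hdvd hHi0
    rw [show (H i).totalDegree = tdegL (h i) from totalDegree_evalT (h i)] at this
    omega
  · -- (v) the witness derivative at `a`
    rw [SData.toState_F, hasseDeriv_evalT, eval_evalT]
    exact hne

/-- An **algebraic-branch blindness ROW**: a presented state with its certificate data
`(D, g, h, Q, V, α₀, a)` (the coefficient list `cs` is supplied once per batch). [folklore] -/
abbrev AlgRow (K : Type) : Type :=
  SData 4 K × ℕ × Terms 2 K × (Fin 4 → Terms 2 K) × List (Terms 2 K) × Finset (Fin 4) × (Fin 4 → ℕ) × (Fin 4 → K)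

/-- Running the certificate of a row. [folklore] -/
def rowAlgB (q : ℕ) (cs : List K) (r : AlgRow K) : Bool :=
  algBlindB q r.1 cs r.2.1 r.2.2.1 r.2.2.2.1 r.2.2.2.2.1 r.2.2.2.2.2.1 r.2.2.2.2.2.2.1 r.2.2.2.2.2.2.2

/-- A passing row's state is BLIND. [folklore] -/
theorem not_inCoordinateScope_of_rowAlgB {q : ℕ} {cs : List K} (hcs : ∀ c : K, c ∈ cs) {r : AlgRow K}
    (h : rowAlgB q cs r = true) : ¬ InCoordinateScope q r.1.toState.F :=
  not_inCoordinateScope_of_algBlindB hcs h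

/-- **Batch form**: every state of a list of passing rows is BLIND (leaf supply for res-dim4-p-14's
`InScopeWinCert.leaves_of_not_inCoordinateScope`). [folklore] -/
theorem not_inCoordinateScope_of_all_rowAlgB {q : ℕ} {cs : List K} (hcs : ∀ c : K, c ∈ cs)
    {rows : List (AlgRow K)} (h : rows.all (rowAlgB q cs) = true) :
    ∀ r ∈ rows, ¬ InCoordinateScope q r.1.toState.F :=
  fun r hr => not_inCoordinateScope_of_rowAlgB hcs (List.all_eq_true.mp h r hr)

/-- Over `𝔽₂` the coefficient list `[0, 1]` is exhaustive. [folklore] -/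
theorem mem_coeffs_zmod2 : ∀ c : ZMod 2, c ∈ ([0, 1] : List (ZMod 2)) := by decide

/-! ## §3 Acceptance: a genus-one blind state of the band-closure census (`q = 2`, `𝔽₂`) -/

/-- The band-closure state `x₂x₄ + x₂x₃x₄² + x₂x₃²` (`r = (0,1,0,0)`, `exc = {x₂}`): child of the RUN 4b band
root S1a-8ddcb084bb `x₃x₄² + x₂x₃² + x₂²x₄` under the centre `V(z, x₂, x₃, x₄)`, chart `x₂`, origin. [folklore] -/
def genusOneSpec : SData 4 (ZMod 2) :=
  ⟨[(![0, 1, 0, 1], 1), (![0, 1, 1, 2], 1), (![0, 1, 2, 0], 1)], ![0, 1, 0, 0], {1}⟩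

/-- The plane cubic `t y² + y + t²` (`= Y² + Y + t³` after `Y = t y`: genus one, no rational parametrisation).
[folklore] -/
def cubicG : Terms 2 (ZMod 2) := [(![1, 2], 1), (![0, 1], 1), (![2, 0], 1)]

/-- The branch `x₁ ↦ 0, x₂ ↦ 0, x₃ ↦ t, x₄ ↦ y`. [folklore] -/
def branchH : Fin 4 → Terms 2 (ZMod 2) := ![[], [], [(![1, 0], 1)], [(![0, 1], 1)]]

/-- The certificate checks (`decide`): `∂₂F = x₄ + x₃x₄² + x₃² ↦ g` (quotient `1`), the other partials `↦ 0`
(quotient `0`), `V = {x₁, x₂}`, witness `∂₂F(0,0,0,1) = 1`. -/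
theorem algBlindB_genusOne :
    algBlindB 2 genusOneSpec [0, 1] 3 cubicG branchH [[], [], [(![0, 0], 1)], []] {0, 1} ![0, 1, 0, 0]
      ![0, 0, 0, 1] = true := by
  decide

/-- **The genus-one state is BLIND** (`¬ InCoordinateScope 2`), by an algebraic, non-rational branch. [folklore] -/
theorem not_inCoordinateScope_genusOne : ¬ InCoordinateScope 2 genusOneSpec.toState.F :=
  not_inCoordinateScope_of_algBlindB (cs := [0, 1]) (by decide) algBlindB_genusOne

end ScopeBlind

end Summit.ResolutionOfSingularities.ResolutionOfSingularities.Theorems.PIDim4
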